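import Mathlib
import Summits.MatrixMultiplication.MatrixMultiplication.Theorems.FidelityWitnessesFidelityGapTwoSixExplicitDefs

/-!
# `FidelityGapTwoSixExplicit` — the explicit kernel `𝒩 = Λ²U ⊗ S³V* ⊗ W*`: table facts and its projection

Part of the proof of `FidelityWitnesses.FidelityGapTwoSixExplicit` (stmt-MatrixMultiplication-14041); see
the vocabulary file `FidelityWitnessesFidelityGapTwoSixExplicitDefs.lean` for the line of argument.  Here:
the integer tables `kerTab` are alternating, `U`-off-diagonal, symmetric in the two `V*`-indices,
pairwise orthogonal with square norms `kerNsq`, killed by the symmetrisation map `phiA` and by the slice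
contraction `sliceMap` (all decided by the kernel); elements of `kerSpan` put exactly half of their mass
on the `U`-block `(0, 1)`; the closed-form map `kerProj` is the orthogonal projection onto `kerSpan`
(idempotent, self-adjoint on `kerSpan`, Pythagoras, best approximation).
-/

noncomputable section

namespace Summit.MatrixMultiplication.MatrixMultiplication.Theorems.GapTwoSixExplicit

-- single-conjunct summit: the `Summit.<S>.<P>` prefix repeats `MatrixMultiplication` by design (D-0017)
set_option linter.dupNamespace false

open scoped BigOperators ComplexConjugate InnerProductSpace
open Literature.Computability.AlgebraicComplexity

/-! ## Integer table facts (kernel-decided) -/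

/-- The kernel tables are killed by the `(210)`-symmetrisation. [folklore] -/
theorem kerTab_phi (ws : Fin 2 × Fin 4) (q : P2 × (P2 × P2)) :
    kerTab ws ((q.1, q.2.2), q.2.1) + kerTab ws ((q.2.1, q.2.2), q.1) = 0 := by
  revert ws q; decide

/-- The kernel tables are alternating in the two `A`-indices. [folklore] -/
theorem kerTab_antisym (ws : Fin 2 × Fin 4) (p : (P2 × P2) × P2) :
    kerTab ws ((p.2, p.1.2), p.1.1) = -kerTab ws p := by
  revert ws p; decide

/-- The kernel tables vanish on the `U`-diagonal blocks. [folklore] -/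
theorem kerTab_diagU (ws : Fin 2 × Fin 4) (p : (P2 × P2) × P2) (h : p.1.1.1 = p.2.1) :
    kerTab ws p = 0 := by
  revert ws p; decide

/-- The kernel tables are symmetric in the two `V*`-indices (the cubic is symmetric). [folklore] -/
theorem kerTab_symJV (ws : Fin 2 × Fin 4) (j v : Fin 2) (m : P2) :
    kerTab ws (((0, v), m), (1, j)) = kerTab ws (((0, j), m), (1, v)) := by
  revert ws j v m; decide

/-- Gram table of the kernel vectors: orthogonal, square norms `kerNsq`. [folklore] -/
theorem kerTab_gram (a b : Fin 2 × Fin 4) :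
    (∑ p : (P2 × P2) × P2, kerTab a p * kerTab b p) = if a = b then (kerNsq a : ℤ) else 0 := by
  revert a b; decide

/-- The kernel tables annihilate the slices of `⟨2,2,2⟩` (integer form of `sliceMap (kerVec ws) = 0`).
[folklore] -/
theorem kerTab_slice (ws : Fin 2 × Fin 4) (c a : P2) :
    (∑ p : P2 × P2, if (c.1 = p.1.1 ∧ p.1.2 = p.2.1 ∧ c.2 = p.2.2) then kerTab ws (p, a) else 0) = 0 := by
  revert ws c a; decide

/-- The entries of `⟨2,2,2⟩` as an `if`. [folklore] -/
theorem T2_apply (c k m : P2) : T2 c k m = if (c.1 = k.1 ∧ k.2 = m.1 ∧ c.2 = m.2) then 1 else 0 := rfl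

/-! ## The kernel vectors in `V64` -/

/-- Entries of the kernel vectors. [folklore] -/
@[simp] theorem kerVec_apply (ws : Fin 2 × Fin 4) (p : (P2 × P2) × P2) :
    kerVec ws p = (kerTab ws p : ℂ) := rfl

/-- Inner products on `V64` in coordinates. [folklore] -/
theorem inner_V64 (x y : V64) : ⟪x, y⟫_ℂ = ∑ p, conj (x p) * y p := by
  simp only [PiLp.inner_apply, RCLike.inner_apply']

/-- Gram matrix of the kernel vectors. [folklore] -/
theorem inner_kerVec_kerVec (a b : Fin 2 × Fin 4) :
    ⟪kerVec a, kerVec b⟫_ℂ = if a = b then (kerNsq a : ℂ) else 0 := by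
  rw [inner_V64]
  have h := kerTab_gram a b
  have h' : (∑ p : (P2 × P2) × P2, conj (kerVec a p) * kerVec b p)
      = ((∑ p : (P2 × P2) × P2, kerTab a p * kerTab b p : ℤ) : ℂ) := by
    push_cast
    refine Finset.sum_congr rfl fun p _ => ?_
    simp [kerVec_apply]
  rw [h', h]
  split_ifs <;> simp

/-- The square norms are positive. [folklore] -/
theorem kerNsq_pos (ws : Fin 2 × Fin 4) : 0 < kerNsq ws := by
  unfold kerNsq; split_ifs <;> norm_num

/-- `‖n_{w,s}‖² = kerNsq`. [folklore] -/
theorem norm_sq_kerVec (ws : Fin 2 × Fin 4) : ‖kerVec ws‖ ^ 2 = (kerNsq ws : ℝ) := by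
  have h := inner_kerVec_kerVec ws ws
  rw [if_pos rfl] at h
  have h2 : (‖kerVec ws‖ ^ 2 : ℂ) = (kerNsq ws : ℂ) := by
    rw [← h, inner_self_eq_norm_sq_to_K]; norm_cast
  exact_mod_cast h2

/-- The kernel vectors are non-zero. [folklore] -/
theorem kerVec_ne_zero (ws : Fin 2 × Fin 4) : kerVec ws ≠ 0 := by
  intro h
  have h1 := norm_sq_kerVec ws
  rw [h, norm_zero] at h1
  have := kerNsq_pos ws
  have : (0 : ℝ) < kerNsq ws := by exact_mod_cast this
  nlinarith

/-- `phiA` kills the kernel vectors. [folklore] -/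
theorem phiA_kerVec (ws : Fin 2 × Fin 4) : phiA (kerVec ws) = 0 := by
  funext q
  simp only [phiA, LinearMap.coe_mk, AddHom.coe_mk, kerVec_apply, Pi.zero_apply]
  have h := kerTab_phi ws q
  exact_mod_cast h

/-- `sliceMap` kills the kernel vectors (they lie in `K ⊗ A*`). [folklore] -/
theorem sliceMap_kerVec (ws : Fin 2 × Fin 4) : sliceMap (kerVec ws) = 0 := by
  funext ca
  simp only [sliceMap, LinearMap.coe_mk, AddHom.coe_mk, kerVec_apply, Pi.zero_apply, T2_apply]
  have h := kerTab_slice ws ca.1 ca.2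
  have h' : (∑ p : P2 × P2, (kerTab ws (p, ca.2) : ℂ) *
      (if (ca.1.1 = p.1.1 ∧ p.1.2 = p.2.1 ∧ ca.1.2 = p.2.2) then 1 else 0))
      = ((∑ p : P2 × P2, if (ca.1.1 = p.1.1 ∧ p.1.2 = p.2.1 ∧ ca.1.2 = p.2.2) then kerTab ws (p, ca.2)
          else 0 : ℤ) : ℂ) := by
    push_cast
    refine Finset.sum_congr rfl fun p _ => ?_
    split_ifs <;> simp
  rw [h', h]; simp

/-! ## Structural facts on `kerSpan` -/

/-- Elements of `kerSpan` are alternating in the two `A`-indices. [folklore] -/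
theorem kerSpan_antisym {e : V64} (he : e ∈ kerSpan) (p : (P2 × P2) × P2) :
    e ((p.2, p.1.2), p.1.1) = -e p := by
  induction he using Submodule.span_induction generalizing p with
  | mem x hx =>
    obtain ⟨ws, rfl⟩ := hx
    simp only [kerVec_apply]
    exact_mod_cast kerTab_antisym ws p
  | zero => simp
  | add x y _ _ hx hy => simp only [PiLp.add_apply, hx, hy]; ring
  | smul c x _ hx => simp only [PiLp.smul_apply, smul_eq_mul, hx]; ring

/-- Elements of `kerSpan` vanish on the `U`-diagonal blocks. [folklore] -/
theorem kerSpan_diagU {e : V64} (he : e ∈ kerSpan) (p : (P2 × P2) × P2) (h : p.1.1.1 = p.2.1) :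
    e p = 0 := by
  induction he using Submodule.span_induction generalizing p with
  | mem x hx =>
    obtain ⟨ws, rfl⟩ := hx
    simp only [kerVec_apply]
    exact_mod_cast kerTab_diagU ws p h
  | zero => simp
  | add x y _ _ hx hy => simp only [PiLp.add_apply, hx p h, hy p h, add_zero]
  | smul c x _ hx => simp only [PiLp.smul_apply, smul_eq_mul, hx p h, mul_zero]

/-- Elements of `kerSpan` are symmetric in the two `V*`-indices. [folklore] -/
theorem kerSpan_symJV {e : V64} (he : e ∈ kerSpan) (j v : Fin 2) (m : P2) :
    e (((0, v), m), (1, j)) = e (((0, j), m), (1, v)) := by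
  induction he using Submodule.span_induction generalizing j v m with
  | mem x hx =>
    obtain ⟨ws, rfl⟩ := hx
    simp only [kerVec_apply]
    exact_mod_cast kerTab_symJV ws j v m
  | zero => simp
  | add x y _ _ hx hy => simp only [PiLp.add_apply, hx, hy]
  | smul c x _ hx => simp only [PiLp.smul_apply, smul_eq_mul, hx]

/-- Norms on `V64` in coordinates. [folklore] -/
theorem norm_sq_V64 (x : V64) : ‖x‖ ^ 2 = ∑ p, ‖x p‖ ^ 2 := EuclideanSpace.norm_sq_eq x

/-- Elements of `kerSpan` carry exactly half of their square norm on the `U`-block `(0, 1)`: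
`Σ_{j,m,v} |e ((0,j),m,(1,v))|² = ‖e‖² / 2`. [folklore] -/
theorem kerSpan_half_norm_sq {e : V64} (he : e ∈ kerSpan) :
    (∑ j : Fin 2, ∑ m : P2, ∑ v : Fin 2, ‖e (((0, j), m), (1, v))‖ ^ 2) = ‖e‖ ^ 2 / 2 := by
  -- split the full sum over the `U`-indices `(k.1, k'.1)`; diagonal blocks vanish, the two
  -- off-diagonal blocks agree by antisymmetry
  have hfull : ‖e‖ ^ 2 = ∑ i : Fin 2, ∑ j : Fin 2, ∑ m : P2, ∑ i' : Fin 2, ∑ v : Fin 2,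
      ‖e (((i, j), m), (i', v))‖ ^ 2 := by
    rw [norm_sq_V64]
    simp only [Fintype.sum_prod_type]
  have hdiag : ∀ (i j : Fin 2) (m : P2) (v : Fin 2), ‖e (((i, j), m), (i, v))‖ ^ 2 = 0 := by
    intro i j m v
    rw [kerSpan_diagU he (((i, j), m), (i, v)) rfl]; simp
  have hoff : ∀ (j : Fin 2) (m : P2) (v : Fin 2),
      ‖e (((1, j), m), (0, v))‖ ^ 2 = ‖e (((0, v), m), (1, j))‖ ^ 2 := by
    intro j m v
    have h := kerSpan_antisym he (((0, v), m), (1, j))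
    simp only at h
    rw [h, norm_neg]
  rw [hfull]
  simp only [Fin.sum_univ_two, hdiag, hoff, Finset.sum_const_zero, Finset.sum_add_distrib]
  ring


/-! ## The closed-form projection onto `kerSpan` -/

/-- `kerProj z = Σ (⟪n, z⟫ / ‖n‖²) • n`. [folklore] -/
theorem kerProj_apply (z : V64) :
    kerProj z = ∑ ws : Fin 2 × Fin 4, (⟪kerVec ws, z⟫_ℂ / (kerNsq ws : ℂ)) • kerVec ws := by
  simp only [kerProj, LinearMap.sum_apply, LinearMap.smul_apply, LinearMap.smulRight_apply,
    innerₛₗ_apply_apply, smul_smul]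
  refine Finset.sum_congr rfl fun ws _ => ?_
  congr 1
  ring

/-- The square norms are non-zero complex numbers. [folklore] -/
theorem kerNsq_ne_zero_C (ws : Fin 2 × Fin 4) : (kerNsq ws : ℂ) ≠ 0 := by
  have := kerNsq_pos ws
  exact_mod_cast this.ne'

/-- `⟪n, kerProj z⟫ = ⟪n, z⟫` for every kernel vector `n`. [folklore] -/
theorem inner_kerVec_kerProj (ws : Fin 2 × Fin 4) (z : V64) :
    ⟪kerVec ws, kerProj z⟫_ℂ = ⟪kerVec ws, z⟫_ℂ := by
  rw [kerProj_apply, inner_sum]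
  simp_rw [inner_smul_right, inner_kerVec_kerVec]
  rw [Finset.sum_eq_single ws]
  · rw [if_pos rfl]
    field_simp [kerNsq_ne_zero_C ws]
  · intro b _ hb
    rw [if_neg (Ne.symm hb), mul_zero]
  · intro h; exact absurd (Finset.mem_univ ws) h

/-- `kerProj z ∈ kerSpan`. [folklore] -/
theorem kerProj_mem (z : V64) : kerProj z ∈ kerSpan := by
  rw [kerProj_apply]
  refine Submodule.sum_mem _ fun ws _ => Submodule.smul_mem _ _ ?_
  exact Submodule.subset_span ⟨ws, rfl⟩

/-- `⟪y, kerProj z⟫ = ⟪y, z⟫` for `y ∈ kerSpan`. [folklore] -/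
theorem inner_kerProj_eq_of_mem {y : V64} (hy : y ∈ kerSpan) (z : V64) :
    ⟪y, kerProj z⟫_ℂ = ⟪y, z⟫_ℂ := by
  induction hy using Submodule.span_induction with
  | mem x hx =>
    obtain ⟨ws, rfl⟩ := hx
    exact inner_kerVec_kerProj ws z
  | zero => simp
  | add x y _ _ hx hy => rw [inner_add_left, inner_add_left, hx, hy]
  | smul c x _ hx => rw [inner_smul_left, inner_smul_left, hx]

/-- `y ⊥ (z - kerProj z)` for `y ∈ kerSpan`. [folklore] -/
theorem inner_sub_kerProj_of_mem {y : V64} (hy : y ∈ kerSpan) (z : V64) :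
    ⟪y, z - kerProj z⟫_ℂ = 0 := by
  rw [inner_sub_right, inner_kerProj_eq_of_mem hy, sub_self]

/-- `kerProj` is the identity on `kerSpan`. [folklore] -/
theorem kerProj_eq_self_of_mem {y : V64} (hy : y ∈ kerSpan) : kerProj y = y := by
  have h1 : y - kerProj y ∈ kerSpan := Submodule.sub_mem _ hy (kerProj_mem y)
  have h2 : ⟪y - kerProj y, y - kerProj y⟫_ℂ = 0 := inner_sub_kerProj_of_mem h1 y
  rw [inner_self_eq_zero, sub_eq_zero] at h2
  exact h2.symm

/-- `kerProj` is idempotent. [folklore] -/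
theorem kerProj_kerProj (z : V64) : kerProj (kerProj z) = kerProj z :=
  kerProj_eq_self_of_mem (kerProj_mem z)

/-- `‖kerProj z‖² = Σ |⟪n, z⟫|² / ‖n‖²`. [folklore] -/
theorem norm_sq_kerProj (z : V64) :
    ‖kerProj z‖ ^ 2 = ∑ ws : Fin 2 × Fin 4, ‖⟪kerVec ws, z⟫_ℂ‖ ^ 2 / (kerNsq ws : ℝ) := by
  have h1 : ⟪kerProj z, kerProj z⟫_ℂ = ⟪kerProj z, z⟫_ℂ := inner_kerProj_eq_of_mem (kerProj_mem z) z
  have h2 : ⟪kerProj z, z⟫_ℂ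
      = ∑ ws : Fin 2 × Fin 4, ((‖⟪kerVec ws, z⟫_ℂ‖ ^ 2 / (kerNsq ws : ℝ) : ℝ) : ℂ) := by
    conv_lhs => rw [kerProj_apply]
    rw [sum_inner]
    refine Finset.sum_congr rfl fun ws _ => ?_
    rw [inner_smul_left]
    have hN : (kerNsq ws : ℂ) ≠ 0 := kerNsq_ne_zero_C ws
    rw [map_div₀, Complex.conj_natCast]
    push_cast
    rw [← Complex.conj_mul', div_mul_eq_mul_div]
  have h3 : (‖kerProj z‖ ^ 2 : ℂ) = ⟪kerProj z, kerProj z⟫_ℂ := by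
    rw [inner_self_eq_norm_sq_to_K]; norm_cast
  have h4 : (‖kerProj z‖ ^ 2 : ℂ)
      = ((∑ ws : Fin 2 × Fin 4, ‖⟪kerVec ws, z⟫_ℂ‖ ^ 2 / (kerNsq ws : ℝ) : ℝ) : ℂ) := by
    rw [h3, h1, h2]; push_cast; rfl
  exact_mod_cast h4

/-- Pythagoras for the projection: `‖z - kerProj z‖² = ‖z‖² - ‖kerProj z‖²`. [folklore] -/
theorem norm_sq_sub_kerProj (z : V64) : ‖z - kerProj z‖ ^ 2 = ‖z‖ ^ 2 - ‖kerProj z‖ ^ 2 := by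
  have h : ⟪kerProj z, z - kerProj z⟫_ℂ = 0 := inner_sub_kerProj_of_mem (kerProj_mem z) z
  have h2 := norm_add_sq_eq_norm_sq_add_norm_sq_of_inner_eq_zero (kerProj z) (z - kerProj z) h
  rw [add_sub_cancel] at h2
  linarith

/-- The distance to `kerSpan` is at most the distance to `kerProj z`... and `kerProj z` realises it:
for every `y ∈ kerSpan`, `‖z - kerProj z‖ ≤ ‖z - y‖`. [folklore] -/
theorem norm_sub_kerProj_le {y : V64} (hy : y ∈ kerSpan) (z : V64) : ‖z - kerProj z‖ ≤ ‖z - y‖ := by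
  have h : ⟪kerProj z - y, z - kerProj z⟫_ℂ = 0 :=
    inner_sub_kerProj_of_mem (Submodule.sub_mem _ (kerProj_mem z) hy) z
  have h2 := norm_add_sq_eq_norm_sq_add_norm_sq_of_inner_eq_zero (kerProj z - y) (z - kerProj z) h
  have h3 : kerProj z - y + (z - kerProj z) = z - y := by abel
  rw [h3] at h2
  have h4 : ‖z - kerProj z‖ ^ 2 ≤ ‖z - y‖ ^ 2 := by nlinarith [norm_nonneg (kerProj z - y)]
  exact le_of_pow_le_pow_left₀ two_ne_zero (norm_nonneg _) h4


end Summit.MatrixMultiplication.MatrixMultiplication.Theorems.GapTwoSixExplicit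

end
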